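import Summits.QuantumFields.YangMills.Theorems.ColdStartUniversalityLatticeLangevinEntropicTVMixingSU2
import Mathlib.MeasureTheory.Integral.Layercake
import HarnessLib

/-!
# FROM SETS TO BOUNDED BOREL OBSERVABLES (layer cake): the STRONG FELLER PROPERTY IN TOTAL-VARIATION FORM and EVERY-START / WARM-START
# ERGODICITY FOR ALL BOUNDED BOREL OBSERVABLES of the `SU(2)` lattice Langevin dynamics on `(ℤ/L)³`, `|β'| < 1/12`

Seat `ym-line-csu-p1` (g42), route `ColdStartUniversality` of `Summits/QuantumFields/YangMills`, helper file G74 (`--supports stmt-QuantumFields-24809`).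
§1 is GENERIC: if two finite measures satisfy `|κ₁(A) − κ₂(A)| ≤ c` for every measurable `A`, then `|∫G dκ₁ − ∫G dκ₂| ≤ c·M` for every measurable
`0 ≤ G ≤ M` (layer-cake formula, Mathlib `Integrable.integral_eq_integral_Ioc_meas_le`).  §2 applies it to the set-wise bounds of G67
(`wilson_strongFeller_set`, `wilson_tv_ergodicity_everyStart`) and G73 (`wilson_tv_ergodicity_of_klDiv`), upgrading G61's strong Feller bound from
semicontinuous to ALL bounded Borel observables with the SAME constant:

* ★★ `abs_integral_sub_le_of_measureReal_sub_le` — generic sets ⇒ functions;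
* ★★★ `wilson_strongFeller_borel` — `|∫G dκ_t(Q') − ∫G dκ_t(Q)| ≤ √((1−12|β'|)/(e^{2(1−12|β'|)t} − 1))·M·ρ_L(Q,Q')`, every Borel `0 ≤ G ≤ M`, `t > 0`;
* ★★★ `wilson_ergodicity_everyStart_borel` — `|∫G dκ_(t+s)(Q) − ∫G dμ_(β')| ≤ C_s·e^{−(1−12|β'|)t}·(∫ρ_L(Q,·)dμ_(β'))·M`;
* ★★★ `wilson_ergodicity_of_klDiv_borel` — `|∫G d(κ_(t+s)∘ν) − ∫G dμ_(β')| ≤ C_s·e^{−(1−12|β'|)t}·√(2C·KL(ν‖μ_(β')))·M` (warm starts, volume-free).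

THEOREMS ONLY, no definition, no sorry.  HONEST FRAMING: fixed cut-off, finite volume, `|β'| < 1/12`; nothing `K`-uniform along the route's scaling;
`UniformColdStartMixing` (24809, ASIDE) is not restated; no crux, rung or summit statement is proved; the Yang–Mills mass gap is NOT proved.
-/

set_option autoImplicit false

noncomputable section

namespace Summit.QuantumFields.YangMills.Theorems.ColdStartUniversality

open MeasureTheory ProbabilityTheory Matrix Complex Finset Filter Topology Set InformationTheory
open scoped ComplexConjugate BigOperators NNReal ENNReal
open Literature.Probability.Process Literature.MathematicalPhysics.QuantumFieldTheory
open Literature.MathematicalPhysics.QuantumLattice (fundamentalRep fundamentalLatticeRep continuous_fundamentalRep fundamentalRep_apply fundamentalLatticeRep_N)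

/-! ## §1. Sets ⇒ bounded Borel functions (generic) -/

/-- ★★ **Layer cake: set-wise closeness ⇒ closeness on bounded observables.**  If two finite measures satisfy `|κ₁(A) − κ₂(A)| ≤ c` for every
measurable `A`, then `|∫G dκ₁ − ∫G dκ₂| ≤ c·M` for every measurable `G` with `0 ≤ G ≤ M`. [folklore] -/
theorem abs_integral_sub_le_of_measureReal_sub_le {X : Type*} [MeasurableSpace X] (κ₁ κ₂ : Measure X) [IsFiniteMeasure κ₁] [IsFiniteMeasure κ₂]
    {c : ℝ} (hc : ∀ A : Set X, MeasurableSet A → |κ₁.real A - κ₂.real A| ≤ c)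
    {G : X → ℝ} (hGm : Measurable G) {M : ℝ} (hM : 0 ≤ M) (hG0 : ∀ x, 0 ≤ G x) (hGM : ∀ x, G x ≤ M) :
    |∫ x, G x ∂κ₁ - ∫ x, G x ∂κ₂| ≤ c * M := by
  have hint : ∀ (κ : Measure X) [IsFiniteMeasure κ], Integrable G κ := fun κ _ =>
    (memLp_of_bounded (a := 0) (b := M) (ae_of_all _ fun x => ⟨hG0 x, hGM x⟩) hGm.aestronglyMeasurable 1).integrable le_rfl
  have hlayer : ∀ (κ : Measure X) [IsFiniteMeasure κ], ∫ x, G x ∂κ = ∫ t in Ioc 0 M, κ.real {a | t ≤ G a} := fun κ _ =>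
    (hint κ).integral_eq_integral_Ioc_meas_le (ae_of_all _ hG0) (ae_of_all _ hGM)
  have hmeas : ∀ (κ : Measure X) [IsFiniteMeasure κ], Measurable fun t : ℝ => κ.real {a | t ≤ G a} := fun κ _ =>
    Antitone.measurable fun s t hst => measureReal_mono (fun a (h : t ≤ G a) => hst.trans h)
  have hIon : ∀ (κ : Measure X) [IsFiniteMeasure κ], IntegrableOn (fun t : ℝ => κ.real {a | t ≤ G a}) (Ioc 0 M) volume := fun κ _ =>
    Measure.integrableOn_of_bounded (by rw [Real.volume_Ioc]; exact ENNReal.ofReal_ne_top) (hmeas κ).aestronglyMeasurable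
      (M := κ.real Set.univ) (ae_of_all _ fun t => by
        rw [Real.norm_eq_abs, abs_of_nonneg measureReal_nonneg]; exact measureReal_mono (subset_univ _))
  rw [hlayer κ₁, hlayer κ₂, ← integral_sub (hIon κ₁) (hIon κ₂)]
  have h := norm_setIntegral_le_of_norm_le_const (μ := (volume : Measure ℝ)) (s := Ioc 0 M) (f := fun t : ℝ => κ₁.real {a | t ≤ G a} - κ₂.real {a | t ≤ G a})
    (C := c) (by rw [Real.volume_Ioc]; exact ENNReal.ofReal_lt_top) (fun t _ => by
      rw [Real.norm_eq_abs]; exact hc _ (hGm measurableSet_Ici))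
  rw [Real.volume_real_Ioc_of_le hM, sub_zero, Real.norm_eq_abs] at h
  exact h

/-- The signed variant: `|G| ≤ M` measurable ⇒ `|∫G dκ₁ − ∫G dκ₂| ≤ 2cM` for PROBABILITY measures (apply §1 to `G + M ∈ [0, 2M]`). [folklore] -/
theorem abs_integral_sub_le_of_measureReal_sub_le_abs {X : Type*} [MeasurableSpace X] (κ₁ κ₂ : Measure X) [IsProbabilityMeasure κ₁] [IsProbabilityMeasure κ₂]
    {c : ℝ} (hc : ∀ A : Set X, MeasurableSet A → |κ₁.real A - κ₂.real A| ≤ c)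
    {G : X → ℝ} (hGm : Measurable G) {M : ℝ} (hGM : ∀ x, |G x| ≤ M) :
    |∫ x, G x ∂κ₁ - ∫ x, G x ∂κ₂| ≤ 2 * c * M := by
  rcases isEmpty_or_nonempty X with hX | hX
  · have h1 : ∫ x, G x ∂κ₁ = 0 := by rw [Measure.eq_zero_of_isEmpty κ₁, integral_zero_measure]
    have := measure_univ (μ := κ₁)
    rw [Set.univ_eq_empty_iff.mpr hX, measure_empty] at this
    exact absurd this zero_ne_one
  have hM : 0 ≤ M := (abs_nonneg _).trans (hGM (Classical.arbitrary X))
  have h := abs_integral_sub_le_of_measureReal_sub_le κ₁ κ₂ hc (G := fun x => G x + M) (hGm.add_const M) (M := 2 * M) (by linarith)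
    (fun x => by linarith [abs_le.1 (hGM x)]) (fun x => by linarith [abs_le.1 (hGM x)])
  have hi : ∀ (κ : Measure X) [IsProbabilityMeasure κ], Integrable G κ := fun κ _ =>
    (memLp_of_bounded (a := -M) (b := M) (ae_of_all _ fun x => abs_le.1 (hGM x)) hGm.aestronglyMeasurable 1).integrable le_rfl
  have e : ∀ (κ : Measure X) [IsProbabilityMeasure κ], ∫ x, (G x + M) ∂κ = ∫ x, G x ∂κ + M := fun κ _ => by
    rw [integral_add (hi κ) (integrable_const _), integral_const, probReal_univ, one_smul]
  rw [e κ₁, e κ₂, show ∫ x, G x ∂κ₁ + M - (∫ x, G x ∂κ₂ + M) = ∫ x, G x ∂κ₁ - ∫ x, G x ∂κ₂ by ring] at h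
  linarith

variable {L : ℕ} [NeZero L]

/-! ## §2. The `SU(2)` lattice Langevin dynamics -/

/-- ★★★ **Strong Feller in total-variation form, all bounded Borel observables.**  For `|β'| < 1/12`, every `L`, every realising kernel family `κ`,
every Borel `G : SU(2)^E → [0, M]`, `t > 0` and all `Q, Q'`:  `|∫G dκ_t(Q') − ∫G dκ_t(Q)| ≤ √((1−12|β'|)/(e^{2(1−12|β'|)t} − 1))·M·ρ_L(Q,Q')` —
G61's bound (`wilson_strongFeller_upperSemicontinuous`) without any continuity assumption on `G`. [cite: BakryGentilLedoux2014, Thm 9.7.2] [cite: ShenZhuZhu2022, Theorem 4.2 (4.5)] -/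
theorem wilson_strongFeller_borel (L : ℕ) [NeZero L] (β' : ℝ) (hβ : |β'| < 1 / 12)
    (κ : ℝ≥0 → Kernel (GaugeConfig 3 L (Matrix.specialUnitaryGroup (Fin 2) ℂ))
      (GaugeConfig 3 L (Matrix.specialUnitaryGroup (Fin 2) ℂ))) [∀ t, IsMarkovKernel (κ t)]
    (hreal : ∀ (t : ℝ≥0) (x : GaugeConfig 3 L (Matrix.specialUnitaryGroup (Fin 2) ℂ))
        (Ω : Type) [MeasurableSpace Ω] (P : Measure Ω) [IsProbabilityMeasure P]
        (W : ℝ≥0 → Ω → (Edge 3 L × NoiseIdx 2 → ℝ)) (hW : IsFlatBrownian W P)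
        (U : ℝ≥0 → Ω → GaugeConfig 3 L (Matrix.specialUnitaryGroup (Fin 2) ℂ)),
        (∀ ω, U 0 ω = x) →
        (latticeLangevinDynamics (fundamentalLatticeRep 2) β').IsSolution (fundamentalRep (Fin 2))
          hW.natFiltration P W U →
        κ t x = P.map (U t))
    {G : GaugeConfig 3 L (Matrix.specialUnitaryGroup (Fin 2) ℂ) → ℝ} (hGm : Measurable G) {M : ℝ} (hM : 0 ≤ M)
    (hG0 : ∀ x, 0 ≤ G x) (hGM : ∀ x, G x ≤ M) {t : ℝ≥0} (ht : 0 < (t : ℝ)) (Q Q' : GaugeConfig 3 L (Matrix.specialUnitaryGroup (Fin 2) ℂ)) :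
    |∫ y, G y ∂(κ t Q') - ∫ y, G y ∂(κ t Q)| ≤
      Real.sqrt ((1 - 12 * |β'|) / (Real.exp (2 * (1 - 12 * |β'|) * (t : ℝ)) - 1)) * M *
        Real.sqrt (torusRiemannDistSq (fundamentalLatticeRep 2) Q Q') := by
  have hc : ∀ A : Set (GaugeConfig 3 L (Matrix.specialUnitaryGroup (Fin 2) ℂ)), MeasurableSet A →
      |(κ t Q').real A - (κ t Q).real A| ≤
        Real.sqrt ((1 - 12 * |β'|) / (Real.exp (2 * (1 - 12 * |β'|) * (t : ℝ)) - 1)) * Real.sqrt (torusRiemannDistSq (fundamentalLatticeRep 2) Q Q') :=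
    fun A hA => wilson_strongFeller_set L β' hβ κ hreal hA ht Q Q'
  have h := abs_integral_sub_le_of_measureReal_sub_le (κ t Q') (κ t Q) hc hGm hM hG0 hGM
  calc _ ≤ _ := h
    _ = _ := by ring

/-- ★★★ **Every-start ergodicity for all bounded Borel observables.**  For `|β'| < 1/12`, every `L`, every realising `κ`, every Borel
`G : SU(2)^E → [0, M]`, every start `Q`, `s > 0`, `t ≥ 0`:
`|∫G dκ_(t+s)(Q) − ∫G dμ_(β')| ≤ √((1−12|β'|)/(e^{2(1−12|β'|)s} − 1))·e^{−(1−12|β'|)t}·(∫ρ_L(Q,·)dμ_(β'))·M`. [cite: ShenZhuZhu2022, Theorem 4.2 (4.5)] -/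
theorem wilson_ergodicity_everyStart_borel (L : ℕ) [NeZero L] (β' : ℝ) (hβ : |β'| < 1 / 12)
    (κ : ℝ≥0 → Kernel (GaugeConfig 3 L (Matrix.specialUnitaryGroup (Fin 2) ℂ))
      (GaugeConfig 3 L (Matrix.specialUnitaryGroup (Fin 2) ℂ))) [∀ t, IsMarkovKernel (κ t)]
    (hreal : ∀ (t : ℝ≥0) (x : GaugeConfig 3 L (Matrix.specialUnitaryGroup (Fin 2) ℂ))
        (Ω : Type) [MeasurableSpace Ω] (P : Measure Ω) [IsProbabilityMeasure P]
        (W : ℝ≥0 → Ω → (Edge 3 L × NoiseIdx 2 → ℝ)) (hW : IsFlatBrownian W P)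
        (U : ℝ≥0 → Ω → GaugeConfig 3 L (Matrix.specialUnitaryGroup (Fin 2) ℂ)),
        (∀ ω, U 0 ω = x) →
        (latticeLangevinDynamics (fundamentalLatticeRep 2) β').IsSolution (fundamentalRep (Fin 2))
          hW.natFiltration P W U →
        κ t x = P.map (U t))
    {G : GaugeConfig 3 L (Matrix.specialUnitaryGroup (Fin 2) ℂ) → ℝ} (hGm : Measurable G) {M : ℝ} (hM : 0 ≤ M)
    (hG0 : ∀ x, 0 ≤ G x) (hGM : ∀ x, G x ≤ M) (Q : GaugeConfig 3 L (Matrix.specialUnitaryGroup (Fin 2) ℂ))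
    {s : ℝ≥0} (hs : 0 < (s : ℝ)) (t : ℝ≥0) :
    |∫ y, G y ∂(κ (t + s) Q) - ∫ y, G y ∂(wilsonMeasure (d := 3) (L := L) (fundamentalRep (Fin 2)) β')| ≤
      Real.sqrt ((1 - 12 * |β'|) / (Real.exp (2 * (1 - 12 * |β'|) * (s : ℝ)) - 1)) * Real.exp (-((1 - 12 * |β'|) * (t : ℝ))) *
        (∫ Q', Real.sqrt (torusRiemannDistSq (fundamentalLatticeRep 2) Q Q') ∂(wilsonMeasure (d := 3) (L := L) (fundamentalRep (Fin 2)) β')) * M := by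
  haveI : IsProbabilityMeasure (wilsonMeasure (d := 3) (L := L) (fundamentalRep (Fin 2)) β') :=
    isProbabilityMeasure_wilsonMeasure (d := 3) (L := L) (fundamentalRep (Fin 2)) (continuous_fundamentalRep (Fin 2)) β'
  have hc : ∀ A : Set (GaugeConfig 3 L (Matrix.specialUnitaryGroup (Fin 2) ℂ)), MeasurableSet A →
      |(κ (t + s) Q).real A - (wilsonMeasure (d := 3) (L := L) (fundamentalRep (Fin 2)) β').real A| ≤
        Real.sqrt ((1 - 12 * |β'|) / (Real.exp (2 * (1 - 12 * |β'|) * (s : ℝ)) - 1)) * Real.exp (-((1 - 12 * |β'|) * (t : ℝ))) *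
          ∫ Q', Real.sqrt (torusRiemannDistSq (fundamentalLatticeRep 2) Q Q') ∂(wilsonMeasure (d := 3) (L := L) (fundamentalRep (Fin 2)) β') :=
    fun A hA => wilson_tv_ergodicity_everyStart L β' hβ κ hreal Q hA hs t
  exact abs_integral_sub_le_of_measureReal_sub_le (κ (t + s) Q) _ hc hGm hM hG0 hGM

/-- ★★★ **Warm-start ergodicity for all bounded Borel observables, volume-free constants.**  For `|β'| < 1/12`, every `L`, every realising `κ`,
every initial law `ν` with `KL(ν‖μ_(β')) < ∞`, every Borel `G : SU(2)^E → [0, M]`, `s > 0`, `t ≥ 0`: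
`|∫G d(κ_(t+s)∘ν) − ∫G dμ_(β')| ≤ √((1−12|β'|)/(e^{2(1−12|β'|)s} − 1))·e^{−(1−12|β'|)t}·√(2·(1/(1−12|β'|))·KL(ν‖μ_(β')))·M`.
[cite: ShenZhuZhu2022, Theorem 4.2 (4.5)] [cite: BakryGentilLedoux2014, Thm 9.6.1] -/
theorem wilson_ergodicity_of_klDiv_borel (L : ℕ) [NeZero L] (β' : ℝ) (hβ : |β'| < 1 / 12)
    (κ : ℝ≥0 → Kernel (GaugeConfig 3 L (Matrix.specialUnitaryGroup (Fin 2) ℂ))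
      (GaugeConfig 3 L (Matrix.specialUnitaryGroup (Fin 2) ℂ))) [∀ t, IsMarkovKernel (κ t)]
    (hreal : ∀ (t : ℝ≥0) (x : GaugeConfig 3 L (Matrix.specialUnitaryGroup (Fin 2) ℂ))
        (Ω : Type) [MeasurableSpace Ω] (P : Measure Ω) [IsProbabilityMeasure P]
        (W : ℝ≥0 → Ω → (Edge 3 L × NoiseIdx 2 → ℝ)) (hW : IsFlatBrownian W P)
        (U : ℝ≥0 → Ω → GaugeConfig 3 L (Matrix.specialUnitaryGroup (Fin 2) ℂ)),
        (∀ ω, U 0 ω = x) →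
        (latticeLangevinDynamics (fundamentalLatticeRep 2) β').IsSolution (fundamentalRep (Fin 2))
          hW.natFiltration P W U →
        κ t x = P.map (U t))
    (ν : Measure (GaugeConfig 3 L (Matrix.specialUnitaryGroup (Fin 2) ℂ))) [IsProbabilityMeasure ν]
    (hfin : klDiv ν (wilsonMeasure (d := 3) (L := L) (fundamentalRep (Fin 2)) β') ≠ ∞)
    {G : GaugeConfig 3 L (Matrix.specialUnitaryGroup (Fin 2) ℂ) → ℝ} (hGm : Measurable G) {M : ℝ} (hM : 0 ≤ M)
    (hG0 : ∀ x, 0 ≤ G x) (hGM : ∀ x, G x ≤ M) {s : ℝ≥0} (hs : 0 < (s : ℝ)) (t : ℝ≥0) :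
    |∫ y, G y ∂(κ (t + s) ∘ₘ ν) - ∫ y, G y ∂(wilsonMeasure (d := 3) (L := L) (fundamentalRep (Fin 2)) β')| ≤
      Real.sqrt ((1 - 12 * |β'|) / (Real.exp (2 * (1 - 12 * |β'|) * (s : ℝ)) - 1)) * Real.exp (-((1 - 12 * |β'|) * (t : ℝ))) *
        Real.sqrt (2 * (1 / (1 - 12 * |β'|)) * (klDiv ν (wilsonMeasure (d := 3) (L := L) (fundamentalRep (Fin 2)) β')).toReal) * M := by
  haveI : IsProbabilityMeasure (wilsonMeasure (d := 3) (L := L) (fundamentalRep (Fin 2)) β') :=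
    isProbabilityMeasure_wilsonMeasure (d := 3) (L := L) (fundamentalRep (Fin 2)) (continuous_fundamentalRep (Fin 2)) β'
  haveI : IsProbabilityMeasure (κ (t + s) ∘ₘ ν) := by
    constructor; rw [Measure.bind_apply MeasurableSet.univ (κ (t + s)).measurable.aemeasurable]; simp
  have hc : ∀ A : Set (GaugeConfig 3 L (Matrix.specialUnitaryGroup (Fin 2) ℂ)), MeasurableSet A →
      |(κ (t + s) ∘ₘ ν).real A - (wilsonMeasure (d := 3) (L := L) (fundamentalRep (Fin 2)) β').real A| ≤
        Real.sqrt ((1 - 12 * |β'|) / (Real.exp (2 * (1 - 12 * |β'|) * (s : ℝ)) - 1)) * Real.exp (-((1 - 12 * |β'|) * (t : ℝ))) *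
          Real.sqrt (2 * (1 / (1 - 12 * |β'|)) * (klDiv ν (wilsonMeasure (d := 3) (L := L) (fundamentalRep (Fin 2)) β')).toReal) :=
    fun A hA => wilson_tv_ergodicity_of_klDiv L β' hβ κ hreal ν hfin hA hs t
  exact abs_integral_sub_le_of_measureReal_sub_le (κ (t + s) ∘ₘ ν) _ hc hGm hM hG0 hGM

end Summit.QuantumFields.YangMills.Theorems.ColdStartUniversality

end
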